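import Summits.CriticalPhenomena.PercolationContinuityZ3.Theorems.Transplant.FKConnectivityAllQDualTransport
import HarnessLib

/-!
# Connectivity correlation inequalities for `φ_{w,q}`, every `q > 0` — CONTRACTION TRANSPORT of edge-negative association
# (Potts–Rayleigh supports are closed under contraction minors)

Support file (`--supports stmt-CriticalPhenomena-4575`), FK sub-lane `prim-bschramm-fk-3` (gen 19) of the post-continuity programme;
builds on p205010 (kernel theorem, internal audit signed; external expert review pending).  No definitions, no named facts, no sorries.

Wagner 2008, Thm. 5.8: the class of Potts–Rayleigh matroids is closed under duals, MINORS, direct sums and 2-sums.  In the tree's support-level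
vocabulary (`FK.EdgeNegCorrSupp S q`: every weight vector in `[0,1]^S` gives an edge-negatively associated `φ_{w,q}`) deletion is a
subset (`EdgeNegCorrSupp.mono`, weight `0`), duality is fk-3 g19's `FK.Dual.edgeNegCorrSupp_of_dual`, 2-sums and 1-sums are fk-1 g6 / fk-3 g8.
This file supplies CONTRACTION: contracting the pair `g` of a support `insert g (range e)` on `V` is the same as giving `g` the weight `1`
(`g` almost surely open), and the random-cluster measure of the contracted listed graph `e' : Fin m → Sym2 V'` (same index set; `e' i` =
image of `e i` in the quotient) is the image of `φ_{w,q}` with `w g = 1`, PROVIDED the cluster counts agree up to a constant: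
  `k_V(insert g (e '' t)) = k_{V'}(e' '' t) + c`  for every index set `t`                                  (`hk`)
(`c` counts idle vertices) — proved here in general for the quotient map: `clusterCount_insert_eq_map` (contracting an OPEN pair does not
change the number of clusters: open paths map down, and lift back because `f` identifies exactly `s` and `t`, `reachable_map_iff`).
* **`FK.Contract.edgeNegCorrSupp_of_contract`** (`0 < q`): `EdgeNegCorrSupp (insert g (range e)) q → EdgeNegCorrSupp (range e') q` under `hk`,
  for injective listings with `g ∉ range e` and `e` loop-free (abstract form, `e'` on any `V'`);
* **`FK.Contract.edgeNegCorrSupp_contract`**: the hypothesis-free form for a surjection `f : V → V'` identifying exactly `s, t`, with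
  `e' = f ∘ e` (injective, i.e. no parallel pairs are created).
[cite: Wagner2006, Thm. 5.8, §5.3 (pp. 14–15)] [cite: Grimmett2006, §1.4 eq. (1.20) (p. 15); §3.9 eq. (3.94) (pp. 63–64)]
-/

noncomputable section

namespace Summit.CriticalPhenomena.PercolationContinuityZ3.Theorems

namespace FK

namespace Contract

open MeasureTheory Literature.Probability.LatticeModels Literature.Probability.Percolation
open Literature.Probability.Percolation.BHK2006 (weight)
open Literature.Probability.Percolation.DecisionTree (ind ind_of_mem ind_of_not_mem)
open scoped Classical

variable {V : Type*} {m : ℕ} {e : Fin m → Sym2 V} {g : Sym2 V}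

/-! ### Configurations `insert g (e '' t)` -/

/-- Membership of a listed pair in `insert g (e '' t)` (`g` unlisted). [folklore] -/
theorem mem_insert_image_iff (he : Function.Injective e) (hg : g ∉ Set.range e) (t : Finset (Fin m)) (i : Fin m) :
    e i ∈ insert g ((↑(t.image e) : BondConfig V)) ↔ i ∈ t := by
  rw [Set.mem_insert_iff, Dual.mem_image_iff he]
  exact ⟨fun h => h.resolve_left fun h' => hg ⟨i, h'⟩, Or.inr⟩

/-- `t ↦ insert g (e '' t)` is injective (`g` unlisted, `e` injective). [folklore] -/
theorem insert_image_injective (he : Function.Injective e) (hg : g ∉ Set.range e) :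
    Function.Injective fun t : Finset (Fin m) => insert g ((↑(t.image e) : BondConfig V)) := by
  intro s t h
  ext i
  rw [← mem_insert_image_iff he hg s i, ← mem_insert_image_iff he hg t i,
    show insert g ((↑(s.image e) : BondConfig V)) = insert g ↑(t.image e) from h]

/-- A configuration inside `insert g (range e)` containing `g` is an `insert g (e '' t)`. [folklore] -/
theorem exists_insert_image_eq (ω : BondConfig V) (hω : ω ⊆ insert g (Set.range e)) (hgω : g ∈ ω) :
    ∃ t : Finset (Fin m), insert g ((↑(t.image e) : BondConfig V)) = ω := by
  obtain ⟨t, ht⟩ := Dual.exists_image_eq (e := e) (ω \ {g}) (fun f hf => (hω hf.1).resolve_left hf.2)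
  refine ⟨t, ?_⟩
  rw [ht, Set.insert_sdiff_singleton, Set.insert_eq_of_mem hgω]

section Count

variable {W : Type*} {f : V → W} {s t : V}

/-- **Open paths map down to the contraction**: if `x ↔ y` in `insert st ω`, then `f x ↔ f y` in the image configuration, for any
map `f` with `f s = f t`. [folklore] -/
theorem reachable_map_of_reachable (hst : f s = f t) (ω : BondConfig V) {x y : V}
    (h : (openGraph (insert s(s, t) ω)).Reachable x y) : (openGraph (Sym2.map f '' ω)).Reachable (f x) (f y) := by
  obtain ⟨p⟩ := h
  induction p with
  | nil => exact SimpleGraph.Reachable.refl _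
  | @cons a b c hadj _ ih =>
    refine SimpleGraph.Reachable.trans ?_ ih
    rw [openGraph_adj, Set.mem_insert_iff] at hadj
    obtain ⟨hab | hab, hne⟩ := hadj
    · have hfab : f a = f b := by
        rcases Sym2.eq_iff.1 hab with ⟨rfl, rfl⟩ | ⟨rfl, rfl⟩
        · exact hst
        · exact hst.symm
      rw [hfab]
    · by_cases hfab : f a = f b
      · rw [hfab]
      · exact SimpleGraph.Adj.reachable ((openGraph_adj _ _ _).2 ⟨⟨s(a, b), hab, by simp⟩, hfab⟩)

/-- **Open paths lift from the contraction**: if `f` identifies exactly `s` and `t`, then `f x ↔ f y` in the image configuration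
implies `x ↔ y` in `insert st ω`. [folklore] -/
theorem reachable_of_reachable_map (hinj : ∀ a b, f a = f b → a = b ∨ s(a, b) = s(s, t)) (ω : BondConfig V) {x y : V}
    (h : (openGraph (Sym2.map f '' ω)).Reachable (f x) (f y)) : (openGraph (insert s(s, t) ω)).Reachable x y := by
  -- vertices with the same image are joined (by the pair `st` if distinct)
  have hfib : ∀ a b, f a = f b → (openGraph (insert s(s, t) ω)).Reachable a b := by
    intro a b hab
    rcases hinj a b hab with rfl | hab'
    · exact SimpleGraph.Reachable.refl _
    · by_cases hne : a = b
      · rw [hne]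
      · exact SimpleGraph.Adj.reachable ((openGraph_adj _ _ _).2 ⟨by rw [hab']; exact Set.mem_insert _ _, hne⟩)
  obtain ⟨p⟩ := h
  suffices key : ∀ (u v : W) (p : (openGraph (Sym2.map f '' ω)).Walk u v) (x : V), f x = u → ∀ y, f y = v →
      (openGraph (insert s(s, t) ω)).Reachable x y from key _ _ p x rfl y rfl
  intro u v p
  induction p with
  | nil => intro x hx y hy; exact hfib x y (hx.trans hy.symm)
  | @cons a b c hadj _ ih =>
    intro x hx y hy
    rw [openGraph_adj] at hadj
    obtain ⟨⟨g, hg, hgab⟩, hne⟩ := hadj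
    induction g using Sym2.ind with
    | h a' b' =>
      rw [Sym2.map_mk, Sym2.eq_iff] at hgab
      -- orient the lifted pair so that `f a'' = a`, `f b'' = b`
      obtain ⟨a'', b'', hmem, ha, hb⟩ : ∃ a'' b'' : V, s(a'', b'') ∈ ω ∧ f a'' = a ∧ f b'' = b := by
        rcases hgab with ⟨h1, h2⟩ | ⟨h1, h2⟩
        · exact ⟨a', b', hg, h1, h2⟩
        · exact ⟨b', a', by rw [Sym2.eq_swap]; exact hg, h2, h1⟩
      have hx' : (openGraph (insert s(s, t) ω)).Reachable x a'' := hfib x a'' (hx.trans ha.symm)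
      have hab : (openGraph (insert s(s, t) ω)).Adj a'' b'' :=
        (openGraph_adj _ _ _).2 ⟨Set.mem_insert_of_mem _ hmem, fun h => hne (by rw [← ha, ← hb, h])⟩
      exact hx'.trans (hab.reachable.trans (ih b'' hb y hy))

/-- **Connections in the contraction** (`f` identifies exactly `s, t`): `f x ↔ f y` in `f(ω)` iff `x ↔ y` in `insert st ω`. [folklore] -/
theorem reachable_map_iff (hst : f s = f t) (hinj : ∀ a b, f a = f b → a = b ∨ s(a, b) = s(s, t)) (ω : BondConfig V) (x y : V) :
    (openGraph (Sym2.map f '' ω)).Reachable (f x) (f y) ↔ (openGraph (insert s(s, t) ω)).Reachable x y :=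
  ⟨reachable_of_reachable_map hinj ω, reachable_map_of_reachable hst ω⟩

/-- **Contracting an open pair does not change the number of clusters**: for `f : V → W` surjective, identifying exactly `s` and `t`,
`k_V(insert st ω) = k_{W}(f(ω))`. [cite: Grimmett2006, §1.2 eq. (1.1) (p. 4)] -/
theorem clusterCount_insert_eq_map (hst : f s = f t) (hinj : ∀ a b, f a = f b → a = b ∨ s(a, b) = s(s, t))
    (hsurj : Function.Surjective f) (ω : BondConfig V) :
    clusterCount (insert s(s, t) ω) ∅ = clusterCount (Sym2.map f '' ω) ∅ := by
  unfold clusterCount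
  simp only [wired_empty, sup_bot_eq]
  set G := openGraph (insert s(s, t) ω)
  set G' := openGraph (Sym2.map f '' ω)
  obtain ⟨g, hg⟩ := hsurj.hasRightInverse
  have hgf : ∀ v, G.Reachable (g (f v)) v := fun v => (reachable_map_iff hst hinj ω _ _).1 (by rw [hg (f v)])
  refine Nat.card_congr
    { toFun := SimpleGraph.ConnectedComponent.lift (fun v => G'.connectedComponentMk (f v))
        (fun v w p _ => SimpleGraph.ConnectedComponent.sound (reachable_map_of_reachable hst ω ⟨p⟩))
      invFun := SimpleGraph.ConnectedComponent.lift (fun v' => G.connectedComponentMk (g v'))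
        (fun v' w' p _ => SimpleGraph.ConnectedComponent.sound
          ((reachable_map_iff hst hinj ω _ _).1 (by rw [hg v', hg w']; exact ⟨p⟩)))
      left_inv := ?_
      right_inv := ?_ }
  · intro C
    induction C using SimpleGraph.ConnectedComponent.ind with
    | h v =>
      rw [SimpleGraph.ConnectedComponent.lift_mk, SimpleGraph.ConnectedComponent.lift_mk]
      exact SimpleGraph.ConnectedComponent.sound (hgf v)
  · intro C
    induction C using SimpleGraph.ConnectedComponent.ind with
    | h v' =>
      rw [SimpleGraph.ConnectedComponent.lift_mk, SimpleGraph.ConnectedComponent.lift_mk, hg v']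

end Count

variable [Fintype V]

/-- **The product weight of `insert g (e '' t)`** when `w g = 1` and `w` is supported on `insert g (range e)`:
`∏_i (w(e i) if i ∈ t else 1 − w(e i))` (the factor of `g` is `1`). [cite: Grimmett2006, §1.4 eq. (1.20) (p. 15)] -/
theorem weight_insert_image (he : Function.Injective e) (hg : g ∉ Set.range e) {w : Sym2 V → unitInterval}
    (hw : ∀ f, ((w f : unitInterval) : ℝ) ≠ 0 → f ∈ insert g (Set.range e)) (hwg : ((w g : unitInterval) : ℝ) = 1) (t : Finset (Fin m)) :
    weight (fun f => (w f : ℝ)) (insert g ((↑(t.image e) : BondConfig V))) =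
      ∏ i, (if i ∈ t then ((w (e i) : unitInterval) : ℝ) else 1 - w (e i)) := by
  unfold weight
  rw [← Finset.prod_subset (Finset.subset_univ (insert g (Finset.univ.image e)))]
  · rw [Finset.prod_insert (fun h => hg (by obtain ⟨i, _, hi⟩ := Finset.mem_image.1 h; exact ⟨i, hi⟩)),
      Finset.prod_image fun i _ j _ h => he h]
    dsimp only
    rw [if_pos (Set.mem_insert g _), hwg, one_mul]
    refine Finset.prod_congr rfl fun i _ => ?_
    by_cases hi : i ∈ t
    · rw [if_pos ((mem_insert_image_iff he hg t i).2 hi), if_pos hi]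
    · rw [if_neg (fun h => hi ((mem_insert_image_iff he hg t i).1 h)), if_neg hi]
  · intro f _ hf
    have hf' : f ∉ insert g (Set.range e) := by
      rintro (rfl | ⟨i, rfl⟩)
      · exact hf (Finset.mem_insert_self _ _)
      · exact hf (Finset.mem_insert_of_mem (Finset.mem_image.2 ⟨i, Finset.mem_univ _, rfl⟩))
    have hw0 : ((w f : unitInterval) : ℝ) = 0 := not_not.1 fun h => hf' (hw f h)
    have hfω : f ∉ insert g ((↑(t.image e) : BondConfig V)) := fun h =>
      hf' (by rcases (Set.mem_insert_iff.1 h) with rfl | h; exacts [Set.mem_insert _ _, Set.mem_insert_of_mem _ (Dual.image_subset_range t h)])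
    dsimp only
    rw [if_neg hfω, hw0, sub_zero]

/-- A configuration NOT containing the weight-`1` pair `g` has random-cluster weight `0`. [cite: Grimmett2006, §1.4 eq. (1.20) (p. 15)] -/
theorem rcWeightW_eq_zero_of_not_mem {w : Sym2 V → unitInterval} (hwg : ((w g : unitInterval) : ℝ) = 1) {ω : BondConfig V}
    (hgω : g ∉ ω) (q : ℝ) : rcWeightW w q ∅ ω = 0 := by
  unfold rcWeightW weight
  rw [Finset.prod_eq_zero (Finset.mem_univ g) (by dsimp only; rw [if_neg hgω, hwg, sub_self]), zero_mul]

/-- **Transfer to listed sums** (weight-`1` pair `g`, support `insert g (range e)`): only the configurations `insert g (e '' t)` carry weight.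
[cite: Grimmett2006, §1.4 eq. (1.20) (p. 15)] -/
theorem sum_rcWeightW_mul (he : Function.Injective e) (hg : g ∉ Set.range e) {w : Sym2 V → unitInterval}
    (hw : ∀ f, ((w f : unitInterval) : ℝ) ≠ 0 → f ∈ insert g (Set.range e)) (hwg : ((w g : unitInterval) : ℝ) = 1) (q : ℝ)
    (F : BondConfig V → ℝ) :
    ∑ ω : BondConfig V, rcWeightW w q ∅ ω * F ω =
      ∑ t : Finset (Fin m), rcWeightW w q ∅ (insert g ↑(t.image e)) * F (insert g ↑(t.image e)) := by
  rw [← Finset.sum_subset (Finset.subset_univ (Finset.univ.image fun t : Finset (Fin m) => insert g ((↑(t.image e) : BondConfig V))))]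
  · rw [Finset.sum_image fun s _ t _ h => insert_image_injective he hg h]
  · intro ω _ hω
    by_cases hgω : g ∈ ω
    · have hω' : ¬ ω ⊆ insert g (Set.range e) := by
        intro h
        obtain ⟨t, rfl⟩ := exists_insert_image_eq ω h hgω
        exact hω (Finset.mem_image.2 ⟨t, Finset.mem_univ _, rfl⟩)
      obtain ⟨f, hfω, hf⟩ := Set.not_subset.1 hω'
      have hw0 : ((w f : unitInterval) : ℝ) = 0 := not_not.1 fun h => hf (hw f h)
      unfold rcWeightW weight
      rw [Finset.prod_eq_zero (Finset.mem_univ f) (by dsimp only; rw [if_pos hfω, hw0]), zero_mul, zero_mul]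
    · rw [rcWeightW_eq_zero_of_not_mem hwg hgω, zero_mul]

omit [Fintype V] in
/-- The listed sum against `1_{J_{e i}}` (support with the weight-`1` pair `g`) is the sum over `t ∋ i`. [cite: Grimmett2006, §1.4 eq. (1.20) (p. 15)] -/
theorem sum_ind_openPair (he : Function.Injective e) (hg : g ∉ Set.range e) (W : BondConfig V → ℝ) (i : Fin m) :
    ∑ t : Finset (Fin m), W (insert g ↑(t.image e)) * ind {ω : BondConfig V | e i ∈ ω} (insert g ↑(t.image e)) =
      ∑ t : Finset (Fin m), W (insert g ↑(t.image e)) * (if i ∈ t then 1 else 0) := by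
  refine Finset.sum_congr rfl fun t _ => ?_
  by_cases hi : i ∈ t
  · rw [if_pos hi, ind_of_mem (show insert g ((↑(t.image e) : BondConfig V)) ∈ {ω : BondConfig V | e i ∈ ω} from
      (mem_insert_image_iff he hg t i).2 hi)]
  · rw [if_neg hi, ind_of_not_mem (show insert g ((↑(t.image e) : BondConfig V)) ∉ {ω : BondConfig V | e i ∈ ω} from
      fun h => hi ((mem_insert_image_iff he hg t i).1 h))]

omit [Fintype V] in
/-- The listed sum against `1_{J_{e i} ∩ J_{e j}}` (support with the weight-`1` pair `g`). [cite: Grimmett2006, §1.4 eq. (1.20) (p. 15)] -/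
theorem sum_ind_openPair_inter (he : Function.Injective e) (hg : g ∉ Set.range e) (W : BondConfig V → ℝ) (i j : Fin m) :
    ∑ t : Finset (Fin m), W (insert g ↑(t.image e)) * ind ({ω : BondConfig V | e i ∈ ω} ∩ {ω | e j ∈ ω}) (insert g ↑(t.image e)) =
      ∑ t : Finset (Fin m), W (insert g ↑(t.image e)) * (if i ∈ t ∧ j ∈ t then 1 else 0) := by
  refine Finset.sum_congr rfl fun t _ => ?_
  by_cases hi : i ∈ t ∧ j ∈ t
  · rw [if_pos hi, ind_of_mem (show insert g ((↑(t.image e) : BondConfig V)) ∈ {ω : BondConfig V | e i ∈ ω} ∩ {ω | e j ∈ ω} from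
      ⟨(mem_insert_image_iff he hg t i).2 hi.1, (mem_insert_image_iff he hg t j).2 hi.2⟩)]
  · rw [if_neg hi, ind_of_not_mem (show insert g ((↑(t.image e) : BondConfig V)) ∉ {ω : BondConfig V | e i ∈ ω} ∩ {ω | e j ∈ ω} from
      fun h => hi ⟨(mem_insert_image_iff he hg t i).1 h.1, (mem_insert_image_iff he hg t j).1 h.2⟩)]

/-! ### The contraction: weights agree index by index, cluster counts by `hk` -/

variable {V' : Type*} [Fintype V'] {e' : Fin m → Sym2 V'} {w : Sym2 V → unitInterval} {w' : Sym2 V' → unitInterval} {q : ℝ} {c : ℕ}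

/-- **The random-cluster weights under contraction**: `W(insert g (e '' t)) = q^c · W'(e' '' t)` when the weights agree index by index,
`w g = 1`, and `hk` holds. [cite: Grimmett2006, §1.4 eq. (1.20) (p. 15)] -/
theorem rcWeightW_contract (he : Function.Injective e) (hg : g ∉ Set.range e) (he' : Function.Injective e')
    (hw : ∀ f, ((w f : unitInterval) : ℝ) ≠ 0 → f ∈ insert g (Set.range e)) (hwg : ((w g : unitInterval) : ℝ) = 1)
    (hw' : ∀ f, ((w' f : unitInterval) : ℝ) ≠ 0 → f ∈ Set.range e') (hww : ∀ i, ((w (e i) : unitInterval) : ℝ) = w' (e' i))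
    (hk : ∀ t : Finset (Fin m), clusterCount (insert g ((↑(t.image e) : BondConfig V))) ∅ =
      clusterCount ((↑(t.image e') : BondConfig V')) ∅ + c)
    (t : Finset (Fin m)) :
    rcWeightW w q ∅ (insert g ↑(t.image e)) = q ^ c * rcWeightW w' q ∅ (↑(t.image e')) := by
  unfold rcWeightW
  rw [weight_insert_image he hg hw hwg t, Dual.weight_image he' hw' t, hk t, pow_add]
  have hP : ∏ i, (if i ∈ t then ((w (e i) : unitInterval) : ℝ) else 1 - w (e i)) =
      ∏ i, (if i ∈ t then ((w' (e' i) : unitInterval) : ℝ) else 1 - w' (e' i)) :=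
    Finset.prod_congr rfl fun i _ => by rw [hww i]
  rw [hP]; ring

/-- **Negative correlation transfers to the contraction** (`0 < q`): if `e i, e j` are negatively correlated under `φ_{w,q}` on `V` (with
`w g = 1`), then `e' i, e' j` are negatively correlated under `φ_{w',q}` on the contracted graph.
[cite: Wagner2006, Thm. 5.8 (p. 14)] [cite: Grimmett2006, §3.9 eq. (3.94) (p. 63)] -/
theorem negCorr_contract (he : Function.Injective e) (hg : g ∉ Set.range e) (he' : Function.Injective e')
    (hw : ∀ f, ((w f : unitInterval) : ℝ) ≠ 0 → f ∈ insert g (Set.range e)) (hwg : ((w g : unitInterval) : ℝ) = 1)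
    (hw' : ∀ f, ((w' f : unitInterval) : ℝ) ≠ 0 → f ∈ Set.range e') (hww : ∀ i, ((w (e i) : unitInterval) : ℝ) = w' (e' i))
    (hq : 0 < q)
    (hk : ∀ t : Finset (Fin m), clusterCount (insert g ((↑(t.image e) : BondConfig V))) ∅ =
      clusterCount ((↑(t.image e') : BondConfig V')) ∅ + c)
    (i j : Fin m)
    (hNC : (rcMeasureW w q ∅).real ({ω : BondConfig V | e i ∈ ω} ∩ {ω | e j ∈ ω}) ≤
      (rcMeasureW w q ∅).real {ω : BondConfig V | e i ∈ ω} * (rcMeasureW w q ∅).real {ω : BondConfig V | e j ∈ ω}) :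
    (rcMeasureW w' q ∅).real ({ω : BondConfig V' | e' i ∈ ω} ∩ {ω | e' j ∈ ω}) ≤
      (rcMeasureW w' q ∅).real {ω : BondConfig V' | e' i ∈ ω} * (rcMeasureW w' q ∅).real {ω : BondConfig V' | e' j ∈ ω} := by
  -- both sides as listed sums; the `V`-sums are `q^c` times the `V'`-sums, termwise
  have hV : ∀ X : Set (BondConfig V), (rcMeasureW w q ∅).real X =
      (∑ t : Finset (Fin m), rcWeightW w q ∅ (insert g ↑(t.image e)) * ind X (insert g ↑(t.image e))) /
        ∑ t : Finset (Fin m), rcWeightW w q ∅ (insert g ↑(t.image e)) := by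
    intro X
    rw [rcMeasureW_real_eq_sum_div w hq ∅ X, sum_rcWeightW_mul he hg hw hwg q (ind X)]
    have h := sum_rcWeightW_mul he hg hw hwg q (fun _ => (1 : ℝ))
    simp only [mul_one] at h
    rw [rcPartitionFunctionW, h]
  rw [hV, hV, hV, sum_ind_openPair_inter he hg, sum_ind_openPair he hg, sum_ind_openPair he hg] at hNC
  rw [Dual.real_eq_div he' hw' hq, Dual.real_eq_div he' hw' hq, Dual.real_eq_div he' hw' hq, Dual.sum_ind_openPair_inter he',
    Dual.sum_ind_openPair he', Dual.sum_ind_openPair he']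
  have hscale : ∀ G : Finset (Fin m) → ℝ, ∑ t : Finset (Fin m), rcWeightW w q ∅ (insert g ↑(t.image e)) * G t =
      q ^ c * ∑ t : Finset (Fin m), rcWeightW w' q ∅ (↑(t.image e')) * G t := by
    intro G
    rw [Finset.mul_sum]
    exact Finset.sum_congr rfl fun t _ => by rw [rcWeightW_contract he hg he' hw hwg hw' hww hk t, mul_assoc]
  have hZ1 : ∑ t : Finset (Fin m), rcWeightW w q ∅ (insert g ↑(t.image e)) =
      q ^ c * ∑ t : Finset (Fin m), rcWeightW w' q ∅ (↑(t.image e')) := by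
    simpa only [mul_one] using hscale fun _ => 1
  rw [hscale, hscale, hscale, hZ1] at hNC
  set Z' := ∑ t : Finset (Fin m), rcWeightW w' q ∅ (↑(t.image e'))
  set A' := ∑ t : Finset (Fin m), rcWeightW w' q ∅ (↑(t.image e')) * (if i ∈ t then 1 else 0)
  set B' := ∑ t : Finset (Fin m), rcWeightW w' q ∅ (↑(t.image e')) * (if j ∈ t then 1 else 0)
  set AB' := ∑ t : Finset (Fin m), rcWeightW w' q ∅ (↑(t.image e')) * (if i ∈ t ∧ j ∈ t then 1 else 0)
  have hqc : 0 < q ^ c := pow_pos hq c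
  have hZ'pos : 0 < Z' := Dual.sum_rcWeightW_pos he' hw' hq
  rw [mul_div_mul_left _ _ hqc.ne', mul_div_mul_left _ _ hqc.ne', mul_div_mul_left _ _ hqc.ne'] at hNC
  exact hNC

/-! ### The contracted weight vector and the support-level transport -/

omit [Fintype V] [Fintype V'] in
/-- **Lifting weights to the uncontracted graph**: for `w'` on `V'` there is `w` on `V`, supported on `insert g (range e)`, with `w g = 1`
and `w (e i) = w' (e' i)`. [cite: Grimmett2006, §1.4 eq. (1.20) (p. 15)] -/
theorem exists_lift_weights (he : Function.Injective e) (hg : g ∉ Set.range e) (w' : Sym2 V' → unitInterval) :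
    ∃ w : Sym2 V → unitInterval, (∀ f, ((w f : unitInterval) : ℝ) ≠ 0 → f ∈ insert g (Set.range e)) ∧
      ((w g : unitInterval) : ℝ) = 1 ∧ ∀ i, ((w (e i) : unitInterval) : ℝ) = w' (e' i) := by
  refine ⟨fun f => if f = g then 1 else if h : ∃ i, e i = f then w' (e' (Classical.choose h)) else 0, ?_, ?_, ?_⟩
  · intro f hf
    by_cases hfg : f = g
    · exact hfg ▸ Set.mem_insert _ _
    · by_contra hnot
      have h : ¬ ∃ i, e i = f := fun ⟨i, hi⟩ => hnot (Set.mem_insert_of_mem _ ⟨i, hi⟩)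
      exact hf (by dsimp only; rw [if_neg hfg, dif_neg h]; rfl)
  · dsimp only; rw [if_pos rfl]; rfl
  · intro i
    have hig : e i ≠ g := fun h => hg ⟨i, h⟩
    have h : ∃ j, e j = e i := ⟨i, rfl⟩
    dsimp only
    rw [if_neg hig, dif_pos h, show Classical.choose h = i from he (Classical.choose_spec h)]

/-- **Potts–Rayleigh supports are closed under contraction** (`0 < q`): if `e` (loop-free, injective, `g ∉ range e`) on `V` and `e'` (injective)
on `V'` satisfy `k_V(insert g (e '' t)) = k_{V'}(e' '' t) + c` for every `t` — `e'` lists the images of the pairs `e i` after contracting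
`g` — and every weight vector supported on `insert g (range e)` gives an edge-negatively associated `φ_{·,q}` on `V`, then so does every
weight vector supported on `range e'` on `V'`.  (Wagner 2008, Thm. 5.8: minors of Potts–Rayleigh matroids; here contraction = weight `1`.)
[cite: Wagner2006, Thm. 5.8, §5.3 (pp. 14–15)] [cite: Grimmett2006, §1.4 eq. (1.20) (p. 15); §3.9 eq. (3.94) (p. 63)] -/
theorem edgeNegCorrSupp_of_contract (he : Function.Injective e) (hg : g ∉ Set.range e) (he' : Function.Injective e')
    (hdiag : ∀ i, ¬ (e i).IsDiag) (hq : 0 < q) (c : ℕ)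
    (hk : ∀ t : Finset (Fin m), clusterCount (insert g ((↑(t.image e) : BondConfig V))) ∅ =
      clusterCount ((↑(t.image e') : BondConfig V')) ∅ + c)
    (h : EdgeNegCorrSupp (insert g (Set.range e)) q) : EdgeNegCorrSupp (Set.range e') q := by
  intro w' hw' e₀ f _ hfe
  by_cases hw0 : ((w' e₀ : unitInterval) : ℝ) = 0
  · exact Dual.negCorr_of_weight_zero w' hq f hw0
  by_cases hwf : ((w' f : unitInterval) : ℝ) = 0
  · rw [Set.inter_comm, mul_comm]
    exact Dual.negCorr_of_weight_zero w' hq e₀ hwf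
  obtain ⟨i, rfl⟩ := hw' e₀ hw0
  obtain ⟨j, rfl⟩ := hw' f hwf
  have hij : i ≠ j := fun h => hfe (h ▸ rfl)
  obtain ⟨w, hw, hwg, hww⟩ := exists_lift_weights (e' := e') he hg w'
  exact negCorr_contract he hg he' hw hwg hw' hww hq hk i j (h w hw (e i) (e j) (hdiag i) (fun h => hij (he h).symm))

/-- **Potts–Rayleigh supports are closed under contraction of a pair** (`0 < q`), hypothesis-free form: if `f : V → V'` is surjective and
identifies exactly the ends of the pair `st ∉ range e` (`e` loop-free and injective, with injective image listing `i ↦ f(e i)`), and every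
weight vector supported on `insert st (range e)` gives an edge-negatively associated `φ_{·,q}` on `V`, then so does every weight vector
supported on the contracted support `range (f ∘ e)` on `V'`.  (Wagner 2008, Thm. 5.8: minors; with `EdgeNegCorrSupp.mono` = deletion, fk-3
g19's duality and fk-1 g6's 2-sums, all four closure operations of the Potts–Rayleigh class are now tree lemmas.)
[cite: Wagner2006, Thm. 5.8, §5.3 (pp. 14–15)] [cite: Grimmett2006, §1.2 eq. (1.1) (p. 4); §3.9 eq. (3.94) (p. 63)] -/
theorem edgeNegCorrSupp_contract {f : V → V'} {s t : V} (he : Function.Injective e) (hg : s(s, t) ∉ Set.range e)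
    (hdiag : ∀ i, ¬ (e i).IsDiag) (hst : f s = f t) (hinj : ∀ a b, f a = f b → a = b ∨ s(a, b) = s(s, t))
    (hsurj : Function.Surjective f) (he' : Function.Injective fun i => Sym2.map f (e i)) (hq : 0 < q)
    (h : EdgeNegCorrSupp (insert s(s, t) (Set.range e)) q) : EdgeNegCorrSupp (Set.range fun i => Sym2.map f (e i)) q := by
  refine edgeNegCorrSupp_of_contract he hg he' hdiag hq 0 (fun u => ?_) h
  rw [add_zero, clusterCount_insert_eq_map hst hinj hsurj, Finset.coe_image, Finset.coe_image, Set.image_image]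

end Contract

end FK

end Summit.CriticalPhenomena.PercolationContinuityZ3.Theorems

end
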